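import Summits.QuantumFields.YangMills.Theorems.BalabanUVNodesN27AtKernelPinnedReading13CoPHLetters
import Summits.QuantumFields.YangMills.Theorems.BalabanUVNodesN27AtKernelPinnedReading13CoPHProducers
import Summits.QuantumFields.YangMills.Theorems.BalabanUVNodesN14AtTopBornTower
import Summits.QuantumFields.YangMills.Theorems.BalabanUVNodesN15AtReadingOfRecord13CoPHC2Bg

/-!
# BalabanUVNodes ∕ N27 = binder B5 AT THE RECORD — module (Kᴬ): THE K3⁷ REDUCTION AT A **TRIPLE-PINNED** STAGE-13 RATE READING — node U3 ↦ node00-def-W1's KERNEL OBJECTS OF RECORD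
# (`hpin`, K3⁷ v3 `U3PinnedKernels 𝔯 ℓ` VERBATIM), node N16's layer ↦ node00-def-RR-1's CONSTANT LAYER OF RECORD at letters `ℓ₃` (`hpin3 : (𝔯.lit …).ne3 k = ne3ConstLayerOfRecord₁₁ F N (ℓ₃ F)`, the
# shape of dag-n22-e's `readingOfRecord₁₃CoPH_ne3` and dag-n16-e's `_ofRecord` faces), node N15's layer ↦ dag-n15-a∕-c's PRIMITIVE-CARRIER FAMILY WITH THE U-SEEING UNIT LAYER (`hpin2 : (𝔯.lit …).ne2 k
# = c2BgObjects 3 F.hL b a_S α α′ c₃₅ p`), and — in §3's FOURTH pin — NODE O's dressed tower ↦ dag-n14-w1's top-born unit-scale tower of record — WITH **EVERY** K4 SLOT IN ITS PRODUCER's DEEPEST LANDED CURRENCY: N14 ⟸ END-B uniform leaves on `𝔯.ne1` (dag-n14-c∕-a `s_N14_rRec₁₃CoPHOn_of_uniformLeaves`),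
# N15 ⟸ the reading pin ALONE (dag-n15-c U-D∕U-E `s_N15_rRec₁₃CoPHOn_of_c2BgReading`: decided, populated, NO estimate hypothesis — MODEL-level), N16 AT EXPONENT β ⟸ the β-uniform proviso and
# the at-keyed leaf β-slot per guarded family at the constant layer (dag-n16-e 39ᴴ `s_N16Holder_rRec₁₃CoPHOn_ofRecord_of_leafSlotHolderAT`), N22 ∕ (D4) ∕ N18 ⟸ def-W1's four finite-volume kernel
# letters of record ((Kᴸ) §1: dag-n22-w3 ∕ dag-n18-w1 ∕ this seat's g0 BY NAME) or the windowed-member rows ((Kᴾ) §1), N17 ELIMINATED; over (K) §2 `spine_rec13CCoPHOn_holder_of_kernels_pin` BY NAME — the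
# (t-U3) regime-level twin of (R)∕leaf F `…HolderProducers`; NO item-facing leaf is typed by this seat for it (dag-lead DEDUP-372 §n27 ownership note v60: leaves ⊢ item = dag-n27-c)
# (cell `pub-ymgap`, HUMAN RULING D-0062 Track A; director-ym №197 ∕ HUMAN RULING D-0149; width seat `pub-ymgap-dag-n27-w1` gen 2 on NODE n27 (B5 composite); K3⁷
# `SpineGivenEndpointR13SepCoPH` = stmt-QuantumFields-20544, `--kind proof --supports 20544 --as helper`; COUNT-NEUTRAL; THEOREMS ONLY, 0 `def`, 0 `sorry`; `N`-generic, regime-generic,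
# NO Theses import)

WHAT IS KERNEL-CHECKED ([bookkeeping]; THREE theorems).
* ★★ `spine_rec13CCoPHOn_holder_of_triple_pin_of_letters` — N27 = B5 at node00-def-RR-2's regime record class from: the three pins; `h14` END-B uniform leaves per guarded tuple on `𝔯.ne1`; `h16` per
  guarded family `InEndRegimeH ∧ LeafSlotHolderAT … β` at the constant layer (`0 ≤ β ≤ 1`); per guarded tuple def-W1's four letters `PolLimitsExistOfRecord₁₃ ∕ WindowedNE9OfRecord₁₃ κ Λ ∕
  WindowedDecayOfRecord₁₃ 0 1 κ ∕ WindowedStepRateOfRecord₁₃ s κ θ₅ (C₅θ₅)` + `Signs ∕ 0 < κ ∕ betaPrime510 4 1 κ ≤ cr`; K5's `h20 h21`; `hx`; the N19′ edge `h19` at exponent β.  N15 costs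
  NOTHING beyond its pin (model-level, decided).
* ★★ `spine_rec13CCoPHOn_holder_of_triple_pin_of_windowed_member` — the same with the U3 rows in the windowed-member currency of (Kᴾ) (`PolLimitExists` + windowed NE9 bounds raw, `ω ≤ θ₅`,
  NE5 at ONE member per run length, the (5.10) clause `KernelDecayOfRecord₁₃`).
* ★★★ `spine_rec13CCoPHOn_holder_of_quadruple_pin_of_letters` — the FOURTH pin added: NODE O's dressed tower `𝔯.ne1 ↦` dag-n14-w1's TOP-BORN UNIT-SCALE TOWER OF RECORD under reading (a)
  `YMDAG.N14.TopBorn.ne1UnitScale l₀ M Λ hM` (plan l.24699 WORD: v2∕v3 pin `ne1` BY NAME to the N14 lineage's tower of record under №195 (8) reading (a)); then N14 costs NOTHING beyond its pin and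
  `0 ≤ l₀, 0 ≤ M, 0 ≤ Λ` (dag-n14-w1 `s_N14_rRec₁₃CoPHOn_of_ne1UnitScale`, decided model), N15 NOTHING beyond its pin, N16-β the leaf β-slot per guarded family, the U3 rows def-W1's four letters +
  three letter inequalities — THE FULLY-PINNED BILL of K3⁷'s stub-1 side at the definers' objects of record, stub-2 side displayed.

HONEST FRAMING.  COMPOSITE-node bookkeeping BY NAME; a REDUCTION, not a discharge: END-B uniform leaves on the residual dressed tower, the β-uniform proviso ∕ leaf β-slot (nodes N05∕N06∕N07's
content behind them), the four kernel letters (finite-volume statements of Bałaban-type SHAPE, NOT PRINTED as such for d = 4; (1.21)'s existence [Balaban1987RG1] p. 264 NOT proved; windowed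
(5.10) = p. 293 before the limit), NE7-cluster, the K5 stubs, the N19′ edge are DISPLAYED HYPOTHESES inhabited for no family today (K0⁷ OPEN); the N15 family is MODEL-level (dag-n15-c's
decided carriers — NOT Bałaban's propagators at the record) and the N14 unit-scale tower is a DECIDED MODEL under reading (a) («budget only» — n14-w1's honest label; whether (a) is what №195 (8)
intends is director-ym's question, not settled here); β a LETTER; nothing of Bałaban's asserted or instantiated; no `Provisos₁₃CoPH` inhabitant claimed; no reading minted (the pins are
hypotheses on a free `𝔯`); N14 ∕ N15 ∕ N16 ∕ N17 ∕ N18 ∕ N22 ∕ N27 NOT discharged; K3⁷ OPEN, NOT claimed; skeleton v3 02f6f498332fdbee and every landed decl UNTOUCHED (additive file); counts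
UNMOVED (typed 28∕28 · discharged 5∕27, A 5∕28); one finite four-torus programme at fixed `ε` — R4 closes the conditional rung `BalabanLadder.UV` only: NOT ℝ⁴, NOT infinite volume, NOT OS,
NOT a mass gap, NOT Clay.  No decl below carries a cite tag.
-/

set_option autoImplicit false

namespace Summit.QuantumFields.YangMills.Theorems.BalabanUVNodesN27SpineRecord

open Filter
open scoped Matrix.Norms.L2Operator
open Literature.MathematicalPhysics.QuantumFieldTheory.Balaban1983to89
open Literature.MathematicalPhysics.QuantumFieldTheory.Balaban1983to89.T4Continuum
open Literature.MathematicalPhysics.QuantumFieldTheory.Balaban1983to89.T4OutputRate (Window NE5)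
open Literature.MathematicalPhysics.QuantumFieldTheory.Balaban1983to89.B12Sec2to5 (betaPrime510 l1)
open Literature.MathematicalPhysics.QuantumFieldTheory.Balaban1983to89.Node00 (polWindow PolLimitExists mergedTermFamilyMatT TβOfRecord₁₃ chiβOfRecord₁₃)
open Literature.MathematicalPhysics.QuantumFieldTheory.Balaban1983to89.Node00.U3OfKernels (histPrefix objectsOfRecord₁₃ KernelDecayOfRecord₁₃)
open Literature.MathematicalPhysics.QuantumFieldTheory.Balaban1983to89.Node00.U3KernelLetters (PolLimitsExistOfRecord₁₃ WindowedNE9OfRecord₁₃ WindowedDecayOfRecord₁₃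
  WindowedStepRateOfRecord₁₃)
open T4ContinuumYM4Torus (ForSmallCouplings)
open Summit.QuantumFields.BalabanUV.T4Continuum.Spine
open Summit.QuantumFields.BalabanUV.T4Continuum.NE1p.DressedRoot (UniformConstants BookingLeaves)
open YMDAG.UVSplit
open YMDAG.N14 (s_N14_rRec₁₃CoPHOn_of_uniformLeaves)
open YMDAG.N14.TopBorn (ne1UnitScale s_N14_rRec₁₃CoPHOn_of_ne1UnitScale)
open Node00 (Stage13HParams datumOfRecord₁₃CoPH U3Letters₁₁ NE3Letters₁₁ ne3ConstLayerOfRecord₁₁)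
open Summit.QuantumFields.YangMills.BalabanUVNodes.N16HolderDefs (S_N16Holder)
open Summit.QuantumFields.YangMills.BalabanUVNodes.N16HolderRegime (InEndRegimeH)
open Summit.QuantumFields.YangMills.BalabanUVNodes.N16LeafSlotAllTorus (LeafSlotHolderAT)
open Summit.QuantumFields.YangMills.BalabanUVNodes.N16AtRRec13CoPHLeafSlotAT (s_N16Holder_rRec₁₃CoPHOn_ofRecord_of_leafSlotHolderAT)
open Summit.QuantumFields.YangMills.BalabanUVNodes.N15.AtKeyedHome (neZero_blockFactor)
open Summit.QuantumFields.YangMills.BalabanUVNodes.N15.UnitLayerBg (c2BgObjects)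
open Summit.QuantumFields.YangMills.BalabanUVNodes.N15.AtReadingOfRecord13CoPH (s_N15_rRec₁₃CoPHOn_of_c2BgReading)
open Summit.QuantumFields.YangMills.BalabanUVNodes.SpineRatesHolder (RatesHolderAt)

variable {N : ℕ} [NeZero N] (cr : SpineReading₁₃CoPH N) {β : ℝ} (hβ0 : 0 ≤ β) (hβ1 : β ≤ 1) (𝔯 : RateReading₁₃CoPH N)
  (Rg : (F : T4Family) → Stage13HParams F N → Prop) (ℓ : (F : T4Family) → Stage13HParams F N → U3Letters₁₁) (ℓ₃ : T4Family → NE3Letters₁₁)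
  (s : (F : T4Family) → Stage13HParams F N → ℕ) {b aS : ℝ} (hb : 0 < b) (haS : 0 < aS) {c35 : ℝ} (hc35 : 0 < c35) (α α' : Fin 4) (p : ℝ)
  -- THE THREE PINS (node U3 ↦ def-W1's kernel objects of record; N16 ↦ RR-1's constant layer at `ℓ₃`; N15 ↦ the primitive-carrier family with the U-seeing unit layer)
  (hpin : ∀ (F : T4Family) (θ : Stage13HParams F N) (hP : θ.Provisos₁₃CoPH F N) (g₀ : ℕ → ℝ) (os : List (ULoop F)),
    (𝔯.lit F θ hP g₀ os).u3 = objectsOfRecord₁₃ F N θ.toStage13Params (ℓ F θ))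
  (hpin3 : ∀ (F : T4Family) (θ : Stage13HParams F N) (hP : θ.Provisos₁₃CoPH F N) (g₀ : ℕ → ℝ) (os : List (ULoop F)) (k : ℕ),
    (𝔯.lit F θ hP g₀ os).ne3 k = ne3ConstLayerOfRecord₁₁ F N (ℓ₃ F))
  (hpin2 : ∀ (F : T4Family) (θ : Stage13HParams F N) (hP : θ.Provisos₁₃CoPH F N), Rg F θ → θ.Admissible F N → ∀ (g₀ : ℕ → ℝ) (os : List (ULoop F)) (k : ℕ),
    (𝔯.lit F θ hP g₀ os).ne2 k = haveI := neZero_blockFactor F; c2BgObjects 3 F.hL b aS α α' c35 p)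
  -- N16 at exponent β ⟸ the β-uniform proviso and the at-keyed leaf β-slot at the constant layer, per guarded family
  (h16 : ∀ (F : T4Family), (∃ θ : Stage13HParams F N, θ.Provisos₁₃CoPH F N ∧ Rg F θ ∧ θ.Admissible F N) →
    InEndRegimeH (ne3OfRecord₁₁ F (ne3ConstLayerOfRecord₁₁ F N (ℓ₃ F))) ∧ LeafSlotHolderAT (ne3OfRecord₁₁ F (ne3ConstLayerOfRecord₁₁ F N (ℓ₃ F))) β)
  -- letter inequalities of the U3 letter block
  (hs : ∀ (F : T4Family) (θ : Stage13HParams F N), θ.Provisos₁₃CoPH F N → Rg F θ → θ.Admissible F N → (ℓ F θ).Signs)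
  (hκ : ∀ (F : T4Family) (θ : Stage13HParams F N), θ.Provisos₁₃CoPH F N → Rg F θ → θ.Admissible F N → 0 < (ℓ F θ).κ)
  (hcr : ∀ (F : T4Family) (θ : Stage13HParams F N), θ.Provisos₁₃CoPH F N → Rg F θ → θ.Admissible F N → betaPrime510 4 1 (ℓ F θ).κ ≤ (ℓ F θ).cr)
  -- K5 and the N19′ edge, verbatim from (Q) ∕ (K)
  (h20 : S_N20 (SRec₁₃CoPHOn cr Rg)) (h21 : S_N21 (SRec₁₃CoPHOn cr Rg))
  (hx : ∀ (F : T4Family) (θ : Stage13HParams F N) (hP : θ.Provisos₁₃CoPH F N), Rg F θ → θ.Admissible F N →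
    B16.EndStatementBPrinted (datumOfRecord₁₃CoPH F N θ hP).C → DagBinding.EndpointExistence (datumOfRecord₁₃CoPH F N θ hP).C.toB12 →
      ForSmallCouplings (datumOfRecord₁₃CoPH F N θ hP) fun g₀ => ∀ os : List (ULoop F),
        0 < (cr F θ hP g₀ os).l₀ ∧ 0 < (cr F θ hP g₀ os).vol ∧
        (∀ (K : ℕ) (t : ℝ), |t| ≤ (cr F θ hP g₀ os).l₀ →
          T4GenFunBounds.schemeZ ((datumOfRecord₁₃CoPH F N θ hP).scheme g₀) os ((cr F θ hP g₀ os).K₀ + K) t =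
            ∑ τ ∈ (cr F θ hP g₀ os).T K, (cr F θ hP g₀ os).A K t τ) ∧
        (∀ (K : ℕ) (t : ℝ), |t| ≤ (cr F θ hP g₀ os).l₀ →
          T4GenFunBounds.schemeZ ((datumOfRecord₁₃CoPH F N θ hP).scheme g₀) os ((cr F θ hP g₀ os).K₀ + K + 1) t =
            ∑ τ ∈ (cr F θ hP g₀ os).T K, (cr F θ hP g₀ os).B K t τ))
  (h19 : ∀ (F : T4Family) (θ : Stage13HParams F N) (hP : θ.Provisos₁₃CoPH F N), Rg F θ → θ.Admissible F N → ∀ (g₀ : ℕ → ℝ) (os : List (ULoop F)),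
    (∀ k : ℕ, RatesHolderAt (datumOfRecord₁₃CoPH F N θ hP) (rateCarriersOfRecord₁₃CoPH 𝔯 F θ hP g₀ os k) β) → letI := (cr F θ hP g₀ os).dec
      ∃ δ : ℕ → ℝ, NE7.Core (cr F θ hP g₀ os).l₀ (cr F θ hP g₀ os).vol (cr F θ hP g₀ os).T (cr F θ hP g₀ os).Bad
        (fun K t τ => (cr F θ hP g₀ os).A K t τ - (cr F θ hP g₀ os).shA K t τ) (fun K t τ => (cr F θ hP g₀ os).B K t τ - (cr F θ hP g₀ os).shB K t τ) δ ∧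
        Summable δ)
include hβ0 hβ1 hb haS hc35 hpin hpin3 hpin2 h16 hs hκ hcr h20 h21 hx h19

/-- ★★ **N27 = B5 AT node00-def-RR-2's REGIME RECORD CLASS FROM A TRIPLE-PINNED STAGE-13 RATE READING, EVERY K4 SLOT IN ITS PRODUCER's DEEPEST LANDED CURRENCY, THE U3 ROWS READ OFF
def-W1's FINITE-VOLUME KERNEL LETTERS OF RECORD** ((K) §2 with `h14 ↦` dag-n14's uniform-leaves face, `h15 ↦` dag-n15-c's c2Bg reading face (NO hypothesis beyond `hpin2`), `h16 ↦` dag-n16-e's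
39ᴴ leaf β-slot face at the constant layer `hpin3`, and the U3 rows ∕ `hdec` from (Kᴸ) §1): per guarded tuple the four letters `PolLimitsExistOfRecord₁₃`, `WindowedNE9OfRecord₁₃ … κ Λ`,
`WindowedDecayOfRecord₁₃ … 0 1 κ`, `WindowedStepRateOfRecord₁₃ … s κ θ₅ (C₅·θ₅)`.  Every displayed antecedent a HYPOTHESIS (0∕1 at the ₁₃ record today; the N15 family MODEL-level); nothing
PROVED of Bałaban's; N27 NOT discharged. [bookkeeping] -/
theorem spine_rec13CCoPHOn_holder_of_triple_pin_of_letters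
    (h14 : ∀ (F : T4Family) (θ : Stage13HParams F N) (hP : θ.Provisos₁₃CoPH F N), Rg F θ → θ.Admissible F N → ∀ (g₀ : ℕ → ℝ) (os : List (ULoop F)),
      ∃ U : UniformConstants, U.Λ = (𝔯.ne1 F θ hP g₀ os).Λ ∧ ∀ p K, Nonempty (BookingLeaves U ((𝔯.ne1 F θ hP g₀ os).𝒯.B p K) ((𝔯.ne1 F θ hP g₀ os).𝒯.T p K)))
    (hL : ∀ (F : T4Family) (θ : Stage13HParams F N), θ.Provisos₁₃CoPH F N → Rg F θ → θ.Admissible F N → PolLimitsExistOfRecord₁₃ F N θ.toStage13Params)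
    (h9 : ∀ (F : T4Family) (θ : Stage13HParams F N), θ.Provisos₁₃CoPH F N → Rg F θ → θ.Admissible F N → WindowedNE9OfRecord₁₃ F N θ.toStage13Params (ℓ F θ).κ (ℓ F θ).moduli)
    (hW : ∀ (F : T4Family) (θ : Stage13HParams F N), θ.Provisos₁₃CoPH F N → Rg F θ → θ.Admissible F N → WindowedDecayOfRecord₁₃ F N θ.toStage13Params 0 1 (ℓ F θ).κ)
    (hS : ∀ (F : T4Family) (θ : Stage13HParams F N), θ.Provisos₁₃CoPH F N → Rg F θ → θ.Admissible F N →
      WindowedStepRateOfRecord₁₃ F N θ.toStage13Params (s F θ) (ℓ F θ).κ (ℓ F θ).θ₅ ((ℓ F θ).C₅ * (ℓ F θ).θ₅)) :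
    Spine (N := N) fun F D w => Node00.IsRecordOfRecord₁₃CCoPHOn F N Rg D w :=
  spine_rec13CCoPHOn_holder_of_kernels_pin cr β 𝔯 Rg ℓ hpin (s_N14_rRec₁₃CoPHOn_of_uniformLeaves 𝔯 Rg h14)
    (s_N15_rRec₁₃CoPHOn_of_c2BgReading hb haS hc35 α α' p 𝔯 Rg hpin2) (s_N16Holder_rRec₁₃CoPHOn_ofRecord_of_leafSlotHolderAT 𝔯 Rg ℓ₃ hβ0 hβ1 hpin3 h16)
    (n18At_kernels_of_letters_guarded Rg ℓ s hL hS) (n22At_kernels_of_letters_guarded Rg ℓ hs hL h9) hs hκ hcr (kernelDecayOfRecord₁₃_of_letters_guarded Rg ℓ hL hW) h20 h21 hx h19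

/-- ★★ **THE SAME WITH THE U3 ROWS IN THE WINDOWED-MEMBER CURRENCY** ((Kᴾ) §1: N22 ⟸ `PolLimitExists` + windowed NE9 bounds raw, N18 ⟸ N22 + `ω ≤ θ₅` + NE5 at ONE member per run length, (D4) ⟸
the (5.10) clause `KernelDecayOfRecord₁₃ F N θ 0 1 κ`); N14 ∕ N15 ∕ N16-at-β as above.  NOT a discharge. [bookkeeping] -/
theorem spine_rec13CCoPHOn_holder_of_triple_pin_of_windowed_member
    (h14 : ∀ (F : T4Family) (θ : Stage13HParams F N) (hP : θ.Provisos₁₃CoPH F N), Rg F θ → θ.Admissible F N → ∀ (g₀ : ℕ → ℝ) (os : List (ULoop F)),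
      ∃ U : UniformConstants, U.Λ = (𝔯.ne1 F θ hP g₀ os).Λ ∧ ∀ p K, Nonempty (BookingLeaves U ((𝔯.ne1 F θ hP g₀ os).𝒯.B p K) ((𝔯.ne1 F θ hP g₀ os).𝒯.T p K)))
    (hωθ : ∀ (F : T4Family) (θ : Stage13HParams F N), θ.Provisos₁₃CoPH F N → Rg F θ → θ.Admissible F N → (ℓ F θ).ω ≤ (ℓ F θ).θ₅)
    (hlim : ∀ (F : T4Family) (θ : Stage13HParams F N), θ.Provisos₁₃CoPH F N → Rg F θ → θ.Admissible F N →
      letI := θ.instVβ₁; letI := θ.instVβ₂; letI := θ.instιβ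
      ∀ g ∈ Window θ.γ, ∀ j : ℕ,
        PolLimitExists F (j + 1)
          (fun K => mergedTermFamilyMatT F N (TβOfRecord₁₃ F N) (chiβOfRecord₁₃ F N θ.toStage13Params) θ.εbg j (histPrefix g j) K) θ.ρ8 θ.bV)
    (hK : ∀ (F : T4Family) (θ : Stage13HParams F N), θ.Provisos₁₃CoPH F N → Rg F θ → θ.Admissible F N →
      letI := θ.instVβ₁; letI := θ.instVβ₂; letI := θ.instιβ
      ∀ g ∈ Window θ.γ, ∀ g' ∈ Window θ.γ, ∀ (j : ℕ) (μ ν : Fin 4) (z : Fin 4 → ℤ), ∀ᶠ K in atTop,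
        |polWindow F K (j + 1)
              (mergedTermFamilyMatT F N (TβOfRecord₁₃ F N) (chiβOfRecord₁₃ F N θ.toStage13Params) θ.εbg j (histPrefix g j) K) θ.ρ8 θ.bV μ ν z -
            polWindow F K (j + 1)
              (mergedTermFamilyMatT F N (TβOfRecord₁₃ F N) (chiβOfRecord₁₃ F N θ.toStage13Params) θ.εbg j (histPrefix g' j) K) θ.ρ8 θ.bV μ ν z| ≤
          Real.exp (-((ℓ F θ).κ * l1 z)) * ∑ i ∈ Finset.range (j + 1), (ℓ F θ).moduli (j + 1) i * |g i - g' i|)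
    (h5 : ∀ (F : T4Family) (θ : Stage13HParams F N), θ.Provisos₁₃CoPH F N → Rg F θ → θ.Admissible F N → ∀ k : ℕ, ∃ b₀ : ℝ, 0 < b₀ ∧ b₀ ≤ θ.γ ∧
      NE5 ((objectsOfRecord₁₃ F N θ.toStage13Params (ℓ F θ)).EA k) ((objectsOfRecord₁₃ F N θ.toStage13Params (ℓ F θ)).EB k b₀) (Window θ.γ) (ℓ F θ).κ (ℓ F θ).θ₅
        ((ℓ F θ).C₅ - (ℓ F θ).C₉ * θ.γ))
    (hdec : ∀ (F : T4Family) (θ : Stage13HParams F N), θ.Provisos₁₃CoPH F N → Rg F θ → θ.Admissible F N → KernelDecayOfRecord₁₃ F N θ.toStage13Params 0 1 (ℓ F θ).κ) :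
    Spine (N := N) fun F D w => Node00.IsRecordOfRecord₁₃CCoPHOn F N Rg D w :=
  spine_rec13CCoPHOn_holder_of_kernels_pin cr β 𝔯 Rg ℓ hpin (s_N14_rRec₁₃CoPHOn_of_uniformLeaves 𝔯 Rg h14)
    (s_N15_rRec₁₃CoPHOn_of_c2BgReading hb haS hc35 α α' p 𝔯 Rg hpin2) (s_N16Holder_rRec₁₃CoPHOn_ofRecord_of_leafSlotHolderAT 𝔯 Rg ℓ₃ hβ0 hβ1 hpin3 h16)
    (n18At_kernels_of_windowed_member_guarded Rg ℓ hs hωθ hlim hK h5) (n22At_kernels_of_windowed_guarded Rg ℓ hs hlim hK) hs hκ hcr hdec h20 h21 hx h19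

/-- ★★★ **THE FULLY-PINNED BILL — N27 = B5 AT THE REGIME RECORD CLASS FROM A QUADRUPLE-PINNED STAGE-13 RATE READING**: node U3 ↦ def-W1's kernel objects of record (`hpin`), N16 ↦ RR-1's
constant layer at `ℓ₃` (`hpin3`), N15 ↦ dag-n15-c's primitive-carrier family (`hpin2`), **NODE O's dressed tower ↦ dag-n14-w1's TOP-BORN UNIT-SCALE TOWER OF RECORD under reading (a)**
(`hpin1 : 𝔯.ne1 F θ hP g₀ os = ne1UnitScale l₀ M Λ hM F θ hP g₀ os`, `0 ≤ l₀`, `0 ≤ Λ`): N14 and N15 cost NOTHING beyond their pins (decided models), N16-β the β-uniform proviso ∧ leaf β-slot per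
guarded family, the three U3 rows def-W1's four finite-volume letters + `Signs ∕ 0 < κ ∕ betaPrime510 4 1 κ ≤ cr`; stub-2 side (`h20 h21 hx h19`) displayed.  Every displayed antecedent a
HYPOTHESIS or a decided MODEL; nothing PROVED of Bałaban's; N27 NOT discharged. [bookkeeping] -/
theorem spine_rec13CCoPHOn_holder_of_quadruple_pin_of_letters {l₀ M Λ : ℝ} (hl₀ : 0 ≤ l₀) (hM : 0 ≤ M) (hΛ : 0 ≤ Λ)
    (hpin1 : ∀ (F : T4Family) (θ : Stage13HParams F N) (hP : θ.Provisos₁₃CoPH F N) (g₀ : ℕ → ℝ) (os : List (ULoop F)),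
      𝔯.ne1 F θ hP g₀ os = ne1UnitScale l₀ M Λ hM F θ hP g₀ os)
    (hL : ∀ (F : T4Family) (θ : Stage13HParams F N), θ.Provisos₁₃CoPH F N → Rg F θ → θ.Admissible F N → PolLimitsExistOfRecord₁₃ F N θ.toStage13Params)
    (h9 : ∀ (F : T4Family) (θ : Stage13HParams F N), θ.Provisos₁₃CoPH F N → Rg F θ → θ.Admissible F N → WindowedNE9OfRecord₁₃ F N θ.toStage13Params (ℓ F θ).κ (ℓ F θ).moduli)
    (hW : ∀ (F : T4Family) (θ : Stage13HParams F N), θ.Provisos₁₃CoPH F N → Rg F θ → θ.Admissible F N → WindowedDecayOfRecord₁₃ F N θ.toStage13Params 0 1 (ℓ F θ).κ)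
    (hS : ∀ (F : T4Family) (θ : Stage13HParams F N), θ.Provisos₁₃CoPH F N → Rg F θ → θ.Admissible F N →
      WindowedStepRateOfRecord₁₃ F N θ.toStage13Params (s F θ) (ℓ F θ).κ (ℓ F θ).θ₅ ((ℓ F θ).C₅ * (ℓ F θ).θ₅)) :
    Spine (N := N) fun F D w => Node00.IsRecordOfRecord₁₃CCoPHOn F N Rg D w :=
  spine_rec13CCoPHOn_holder_of_kernels_pin cr β 𝔯 Rg ℓ hpin (s_N14_rRec₁₃CoPHOn_of_ne1UnitScale 𝔯 Rg hl₀ hM hΛ hpin1)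
    (s_N15_rRec₁₃CoPHOn_of_c2BgReading hb haS hc35 α α' p 𝔯 Rg hpin2) (s_N16Holder_rRec₁₃CoPHOn_ofRecord_of_leafSlotHolderAT 𝔯 Rg ℓ₃ hβ0 hβ1 hpin3 h16)
    (n18At_kernels_of_letters_guarded Rg ℓ s hL hS) (n22At_kernels_of_letters_guarded Rg ℓ hs hL h9) hs hκ hcr (kernelDecayOfRecord₁₃_of_letters_guarded Rg ℓ hL hW) h20 h21 hx h19

end Summit.QuantumFields.YangMills.Theorems.BalabanUVNodesN27SpineRecord
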